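import Literature.Probability.Distributions.LaplaceConcentration
import Literature.Barriers.QuantumFields.DiscreteSubgroupFreezing
import HarnessLib

/-!
# Concentration of the one-plaquette / one-link Wilson weights at the identity as `β → ∞`

For a compact group `G` with a finite measure `μ` positive on open sets (Haar measure) and a continuous
FAITHFUL unitary representation `ρ : G →* M_N(ℂ)` (`ρ g ∈ U(N)`, `ρ` injective, `N ≥ 1`), the Gibbs measures of the
Wilson plaquette energy `s(g) = 1 − (1/N) Re tr ρ(g)` (the tree's `Literature.Barriers.QuantumFields.wilsonEnergy`),
`μ_β(dg) = exp(−β s(g)) μ(dg) / Z_β` (the tree's `Literature.Probability.Distributions.gibbsTilt μ (wilsonEnergy ρ) β`),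
converge weakly to the Dirac mass at the identity: `∫ f dμ_β → f 1` for every continuous `f : G → ℝ`
(`tendsto_integral_gibbsTilt_wilsonEnergy`; sequential form `…_seq`).  Ingredients, all already in the tree and
only assembled here: the Laplace-concentration theorem `tendsto_integral_gibbsTilt_of_unique_min'`
(`Literature/Probability/Distributions/LaplaceConcentration.lean`) and the unique-minimiser facts for unitary matrices
`re_trace_le_of_mem_unitaryGroup` / `eq_one_of_re_trace_eq` (`Re tr U ≤ N`, `= N` only for `U = 1`;
`Literature/Barriers/QuantumFields/DiscreteSubgroupFreezing.lean`), giving `s(1) = 0 < s(g)` for `g ≠ 1`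
(`wilsonEnergy_one`, `wilsonEnergy_pos_of_ne_one`).  Also recorded: up to the `β`-independent normalisation the
weight is the single-plaquette Wilson Boltzmann factor, `gibbsTilt μ (wilsonEnergy ρ) β = μ.tilted (β · χ_N ∘ ρ)` with
`χ_N = normalisedCharacter N` (`gibbsTilt_wilsonEnergy_eq_tilted`, probability `μ`).

Why this file exists (nothing of it is a statement of Bałaban's series; cell `pub-balaban`, REFEREE R36.5 / GAPS
G-ref2-26 (c)): the soloist module `…Balaban1983to89.MassGapFunctionalInequalities` §9 takes as HYPOTHESIS (`hconc`) the
concentration of the one-link conditional law of the Wilson specification at the kernel of `ρ` as `β_k → +∞`; for a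
faithful `ρ` that law, in the unit background, is a `gibbsTilt` of Haar measure by a positive multiple of the Wilson
energy (an identification that is that module's to make), after which the present theorem supplies the limit.  All
declarations are `[folklore]`; no new definition, no named fact.  Deliberately NOT here: the identification with the
tree's `siteLaw (ymSpecification ρ β)`, rates, non-faithful `ρ` (limit law = normalised Haar measure of `ker ρ`).
-/

noncomputable section

namespace Literature.MathematicalPhysics.QuantumLattice

open _root_.MeasureTheory _root_.Filter _root_.Real
open Literature.Probability.Distributions Literature.Barriers.QuantumFields
open scoped _root_.Topology

variable {G : Type*} [Group G]

/-- The Wilson plaquette energy vanishes at the identity: `s(1) = 1 − (1/N) Re tr 1 = 0` (`N ≥ 1`). [folklore] -/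
theorem wilsonEnergy_one {N : ℕ} [NeZero N] (ρ : G →* Matrix (Fin N) (Fin N) ℂ) : wilsonEnergy ρ 1 = 0 := by
  simp [wilsonEnergy, map_one]

/-- For a FAITHFUL unitary representation the Wilson plaquette energy is strictly positive off the identity:
`g ≠ 1 ⇒ 0 < 1 − (1/N) Re tr ρ(g)` — from `Re tr U ≤ N` with equality only at `U = 1`
(`re_trace_le_of_mem_unitaryGroup`, `eq_one_of_re_trace_eq`). [folklore] -/
theorem wilsonEnergy_pos_of_ne_one {N : ℕ} [NeZero N] {ρ : G →* Matrix (Fin N) (Fin N) ℂ}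
    (hρU : ∀ g, ρ g ∈ Matrix.unitaryGroup (Fin N) ℂ) (hρinj : Function.Injective ρ) {g : G} (hg : g ≠ 1) :
    0 < wilsonEnergy ρ g := by
  have hne : ρ g ≠ 1 := fun h => hg (hρinj (by rw [h, map_one]))
  have hle : (ρ g).trace.re ≤ N := re_trace_le_of_mem_unitaryGroup (hρU g)
  have hlt : (ρ g).trace.re < N := lt_of_le_of_ne hle fun h => hne (eq_one_of_re_trace_eq (hρU g) h)
  have hN : (0 : ℝ) < N := Nat.cast_pos.2 (Nat.pos_of_ne_zero (NeZero.ne N))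
  have hlt' : (N : ℝ)⁻¹ * (ρ g).trace.re < (N : ℝ)⁻¹ * N := mul_lt_mul_of_pos_left hlt (inv_pos.2 hN)
  rw [inv_mul_cancel₀ hN.ne'] at hlt'
  unfold wilsonEnergy normalisedCharacter
  linarith

/-- The identity is the UNIQUE minimiser of the Wilson energy of a faithful unitary representation:
`wilsonEnergy ρ 1 < wilsonEnergy ρ g` for `g ≠ 1`. [folklore] -/
theorem wilsonEnergy_one_lt {N : ℕ} [NeZero N] {ρ : G →* Matrix (Fin N) (Fin N) ℂ}
    (hρU : ∀ g, ρ g ∈ Matrix.unitaryGroup (Fin N) ℂ) (hρinj : Function.Injective ρ) (g : G) (hg : g ≠ 1) :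
    wilsonEnergy ρ 1 < wilsonEnergy ρ g := by
  rw [wilsonEnergy_one]; exact wilsonEnergy_pos_of_ne_one hρU hρinj hg

/-- The Wilson energy of a continuous matrix representation is continuous. [folklore] -/
theorem continuous_wilsonEnergy [TopologicalSpace G] {N : ℕ} {ρ : G →* Matrix (Fin N) (Fin N) ℂ}
    (hρc : Continuous ρ) : Continuous (wilsonEnergy ρ) := by
  unfold wilsonEnergy normalisedCharacter
  fun_prop

/-- Up to its `β`-independent normalisation the Gibbs weight of the Wilson energy IS the single-plaquette Wilson
Boltzmann factor `exp(β χ_N(ρ g))`: for a probability measure `μ`,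
`gibbsTilt μ (wilsonEnergy ρ) β = μ.tilted (fun g => β * normalisedCharacter N (ρ g))` (tilting ignores additive
constants). [folklore] -/
theorem gibbsTilt_wilsonEnergy_eq_tilted [MeasurableSpace G] {N : ℕ} (μ : Measure G) [IsProbabilityMeasure μ]
    (ρ : G →* Matrix (Fin N) (Fin N) ℂ) (β : ℝ) :
    gibbsTilt μ (wilsonEnergy ρ) β = μ.tilted fun g => β * normalisedCharacter N (ρ g) := by
  have hfun : (fun g => -β * wilsonEnergy ρ g) = fun g => -β + β * normalisedCharacter N (ρ g) := by
    funext g; simp only [wilsonEnergy]; ring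
  have h := tilted_tilted (μ := μ) (f := fun _ : G => -β) (integrable_const (exp (-β)))
    (fun g => β * normalisedCharacter N (ρ g))
  rw [tilted_const] at h
  rw [gibbsTilt_def, hfun, h]
  rfl

variable [TopologicalSpace G] [MeasurableSpace G] [BorelSpace G] [CompactSpace G]

/-- **The Wilson one-plaquette / one-link weights concentrate at the identity.** For `G` compact, `μ` a finite
measure on `G` positive on open sets (e.g. Haar measure) and `ρ : G →* M_N(ℂ)` a continuous faithful unitary
representation (`N ≥ 1`): `∫ f d(gibbsTilt μ (wilsonEnergy ρ) β) → f 1` as `β → +∞` for every continuous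
`f : G → ℝ`, i.e. `exp(−β(1 − (1/N) Re tr ρ(g))) μ(dg)/Z_β ⇒ δ_1`. [folklore] -/
theorem tendsto_integral_gibbsTilt_wilsonEnergy {N : ℕ} [NeZero N] (μ : Measure G) [IsFiniteMeasure μ]
    [μ.IsOpenPosMeasure] {ρ : G →* Matrix (Fin N) (Fin N) ℂ} (hρc : Continuous ρ)
    (hρU : ∀ g, ρ g ∈ Matrix.unitaryGroup (Fin N) ℂ) (hρinj : Function.Injective ρ) {f : G → ℝ}
    (hf : Continuous f) :
    Tendsto (fun β : ℝ => ∫ g, f g ∂(gibbsTilt μ (wilsonEnergy ρ) β)) atTop (𝓝 (f 1)) :=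
  tendsto_integral_gibbsTilt_of_unique_min' (continuous_wilsonEnergy hρc) (wilsonEnergy_one_lt hρU hρinj) hf

/-- Sequential form: along any `β_k → +∞`. [folklore] -/
theorem tendsto_integral_gibbsTilt_wilsonEnergy_seq {N : ℕ} [NeZero N] (μ : Measure G) [IsFiniteMeasure μ]
    [μ.IsOpenPosMeasure] {ρ : G →* Matrix (Fin N) (Fin N) ℂ} (hρc : Continuous ρ)
    (hρU : ∀ g, ρ g ∈ Matrix.unitaryGroup (Fin N) ℂ) (hρinj : Function.Injective ρ) {f : G → ℝ}
    (hf : Continuous f) {βs : ℕ → ℝ} (hβ : Tendsto βs atTop atTop) :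
    Tendsto (fun k => ∫ g, f g ∂(gibbsTilt μ (wilsonEnergy ρ) (βs k))) atTop (𝓝 (f 1)) :=
  (tendsto_integral_gibbsTilt_wilsonEnergy μ hρc hρU hρinj hf).comp hβ

/-- The same with a positive rescaling of the inverse temperature (the one-link laws of the Wilson specification
are tilts by `c · β · χ_N ∘ ρ` with a lattice constant `c > 0`): `∫ f d(gibbsTilt μ (wilsonEnergy ρ) (c β_k)) → f 1`.
[folklore] -/
theorem tendsto_integral_gibbsTilt_wilsonEnergy_seq_mul {N : ℕ} [NeZero N] (μ : Measure G) [IsFiniteMeasure μ]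
    [μ.IsOpenPosMeasure] {ρ : G →* Matrix (Fin N) (Fin N) ℂ} (hρc : Continuous ρ)
    (hρU : ∀ g, ρ g ∈ Matrix.unitaryGroup (Fin N) ℂ) (hρinj : Function.Injective ρ) {f : G → ℝ}
    (hf : Continuous f) {βs : ℕ → ℝ} (hβ : Tendsto βs atTop atTop) {c : ℝ} (hc : 0 < c) :
    Tendsto (fun k => ∫ g, f g ∂(gibbsTilt μ (wilsonEnergy ρ) (c * βs k))) atTop (𝓝 (f 1)) :=
  (tendsto_integral_gibbsTilt_wilsonEnergy μ hρc hρU hρinj hf).comp (hβ.const_mul_atTop hc)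

end Literature.MathematicalPhysics.QuantumLattice
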